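import Literature.Computability.AlgebraicComplexity.DepthReductionProofs
import Mathlib.Algebra.BigOperators.Fin
import Mathlib.Data.List.GetD
import HarnessLib

/-!
# Gate-list bookkeeping for block constructions (route `DepthWindow`, crux `HomSubReach`)

Prefix stability of `gateValues` and `gateWDepths` (the append lemmas themselves are
`DepthReduction.gateValues_layer` / `gateWDepths_layer` of the Literature), the depth entry
`Gate.depthAgainst` of a gate against a depth list, plus small `List.getD` helpers.  Used by the
Strassen slope-1 homogenisation (`DepthWindowHomFanIn`) and intended for the `HomRelStacks`
prover (stitching homogenised blocks).  Model: Bürgisser's straight-line programs with unbounded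
fan-in and the `prodWeight` depth of Limaye–Srinivasan–Tavenas.

[cite: Burgisser2000, Def. 2.1, proof of Prop. 2.3] [cite: LST2021, §2]
[cite: LimayeSrinivasanTavenas2025, Lemma 19, Lemma 20]
-/

set_option linter.dupNamespace false

namespace Summit.ValiantsHypothesis.ValiantsHypothesis.Theorems.DepthWindow

open MvPolynomial Literature.Computability.AlgebraicComplexity ArithCircuit
open Literature.Computability.AlgebraicComplexity.DepthReduction

variable {k : Type*} [CommSemiring k] {τ : Type*}

/-! ### Append stability for operands that reference a prefix -/

omit [CommSemiring k] in
/-- Monotonicity of `RefsBelow` in the bound. [cite: Burgisser2000, Def. 2.1] -/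
theorem Operand.refsBelow_mono {m n : ℕ} (h : m ≤ n) :
    ∀ {u : Operand k τ}, u.RefsBelow m → u.RefsBelow n
  | .var _, _ => trivial
  | .const _, _ => trivial
  | .gate _, hu => Nat.lt_of_lt_of_le hu h

/-- The depth entry a gate would get against a depth list `D`. -/
def Gate.depthAgainst (wt : Gate k τ → ℕ) (D : List ℕ) (G : Gate k τ) : ℕ :=
  wt G + (G.args.map (Operand.depthIn D)).foldr max 0

omit [CommSemiring k] in
/-- A gate whose operands reference the prefix ignores appended depth entries. [cite: LST2021, §2] -/
theorem Gate.depthAgainst_append_of_argsBelow (wt : Gate k τ → ℕ) (D E : List ℕ) {G : Gate k τ}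
    (h : ∀ u ∈ G.args, u.RefsBelow D.length) : Gate.depthAgainst wt (D ++ E) G = Gate.depthAgainst wt D G := by
  unfold Gate.depthAgainst
  congr 2
  exact List.map_congr_left fun u hu => depthIn_append_of_refsBelow D E (h u hu)

omit [CommSemiring k] in
/-- **Block append, depths.**  Appending a block of gates all of whose operands reference the prefix `Ψ₀` only: the depth entries of the block are computed against the prefix. [cite: LST2021, §2] -/
theorem gateWDepths_append_block (wt : Gate k τ → ℕ) (Ψ₀ : List (Gate k τ)) :
    ∀ (B : List (Gate k τ)), (∀ G ∈ B, ∀ u ∈ G.args, u.RefsBelow Ψ₀.length) →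
      gateWDepths wt (Ψ₀ ++ B) =
        gateWDepths wt Ψ₀ ++ B.map (Gate.depthAgainst wt (gateWDepths wt Ψ₀)) :=
  fun B hB => gateWDepths_layer wt Ψ₀ B hB

/-! ### List bookkeeping -/

/-- Sums over `List.range` as `Finset.range` sums. -/
theorem sum_range_eq_list_sum {β : Type*} [AddCommMonoid β] (n : ℕ) (g : ℕ → β) :
    ∑ i ∈ Finset.range n, g i = ((List.range n).map g).sum := by
  rw [Finset.sum_eq_multiset_sum]
  rfl

/-- `((List.range l.length).map fun i => l.getD i d) = l`. -/
theorem map_getD_range {α : Type*} (d : α) : ∀ l : List α,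
    (List.range l.length).map (fun i => l.getD i d) = l
  | [] => rfl
  | a :: l => by
      rw [List.length_cons, List.range_succ_eq_map, List.map_cons, List.map_map]
      show a :: (List.range l.length).map (fun i => (a :: l).getD (i + 1) d) = a :: l
      rw [show (fun i => (a :: l).getD (i + 1) d) = fun i => l.getD i d from rfl, map_getD_range d l]

/-- Prefix stability of `gateValues`. -/
theorem gateValues_prefix (A : List (Gate k τ)) :
    ∀ B : List (Gate k τ), ∃ X : List (MvPolynomial τ k),
      gateValues (A ++ B) = gateValues A ++ X ∧ X.length = B.length := by
  intro B
  induction B using List.reverseRecOn with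
  | nil => exact ⟨[], by simp, rfl⟩
  | append_singleton B G ih =>
      obtain ⟨X, hX, hlen⟩ := ih
      refine ⟨X ++ [G.eval (gateValues (A ++ B))], ?_, by simp [hlen]⟩
      rw [← List.append_assoc, gateValues_append_singleton, hX, List.append_assoc]

omit [CommSemiring k] in
/-- Prefix stability of `gateWDepths`. -/
theorem gateWDepths_prefix (wt : Gate k τ → ℕ) (A : List (Gate k τ)) :
    ∀ B : List (Gate k τ), ∃ X : List ℕ,
      gateWDepths wt (A ++ B) = gateWDepths wt A ++ X ∧ X.length = B.length := by
  intro B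
  induction B using List.reverseRecOn with
  | nil => exact ⟨[], by simp, rfl⟩
  | append_singleton B G ih =>
      obtain ⟨X, hX, hlen⟩ := ih
      refine ⟨X ++ [Gate.depthAgainst wt (gateWDepths wt (A ++ B)) G], ?_, by simp [hlen]⟩
      rw [← List.append_assoc, gateWDepths_append_singleton, hX, List.append_assoc]
      rfl

/-! ### Small list helpers -/

/-- Reading position `|V| + idx` of `V ++ P` reads position `idx` of `P`. -/
theorem getD_append_length_add {α : Type*} (V P : List α) (dflt : α) (idx : ℕ) :
    (V ++ P).getD (V.length + idx) dflt = P.getD idx dflt := by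
  rw [List.getD_append_right _ _ _ _ (Nat.le_add_right _ _), Nat.add_sub_cancel_left]

/-- `getD` with default `0` of a termwise-bounded list is bounded. -/
theorem getD_le_of_forall_le {l : List ℕ} {M : ℕ} (h : ∀ x ∈ l, x ≤ M) (i : ℕ) :
    l.getD i 0 ≤ M := by
  by_cases hi : i < l.length
  · rw [List.getD_eq_getElem _ _ hi]; exact h _ (List.getElem_mem hi)
  · rw [List.getD_eq_default _ _ (by omega)]; exact Nat.zero_le _

/-- A `List.prod` over a mapped list as a `Finset.prod` over `Fin length`. -/
theorem prod_map_eq_prod_get {M : Type*} [CommMonoid M] {α : Type*} (us : List α) (g : α → M) :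
    (us.map g).prod = ∏ l : Fin us.length, g (us.get l) := by
  rw [← List.prod_ofFn]
  congr 1
  conv_lhs => rw [← List.ofFn_get us]
  rw [List.map_ofFn]
  rfl

/-- Reading position `|l|` of `l ++ [x]` gives `x`. -/
theorem getD_append_at_length {α : Type*} (l : List α) (x dflt : α) {i : ℕ} (hi : i = l.length) :
    (l ++ [x]).getD i dflt = x := by
  subst hi
  rw [List.getD_append_right _ _ _ _ le_rfl, Nat.sub_self, List.getD_cons_zero]

end Summit.ValiantsHypothesis.ValiantsHypothesis.Theorems.DepthWindow
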